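import Literature.Topology.FourManifolds.MMSWPictureGeneralPosition
import Literature.Topology.FourManifolds.TubularNbhdOfLocalDiffeomorph
import Literature.Topology.FourManifolds.TubularNbhdSqueeze
import Literature.Topology.FourManifolds.DehnSurgery
import Literature.Topology.FourManifolds.KirbyMovesReverseProofs
import Mathlib.Analysis.Convex.Contractible
import Mathlib.AlgebraicTopology.FundamentalGroupoid.SimplyConnected
import HarnessLib

/-!
# Thin round tubes of the dotted circles of the standard picture, and their framing

Topic `Literature/Topology/FourManifolds`; first file of the proof of the named fact
`Literature.Topology.FourManifolds.pictureSurgeryPresentation` (`MMSWPictureSurgery.lean`: Kirby's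
Lemma 2.1 — a dotted circle is a `0`-framed unknot on the boundary — read in the standard picture
`MMSW.draw` of the model boundary `M_k = ∂D_k`; Kirby, *The Topology of 4-Manifolds*, LNM 1374
(1989), Ch. I §2, Lemma 2.1; Manolescu–Marengon–Sarkar–Willis, Duke Math. J. 172 (2023),
Def. 8.26 / Remark 8.27).  Everything here is proved; no named fact is introduced.

The dotted circles of the standard picture of `M_k` are the round coaxial horizontal circles
`U_j`, `j < k`, of planar radii `R_j = c_j + C_k = 4(j+1) + drawRadius k` at height `0`
(`dottedCircle`).  This file constructs, for each of them, a THIN ROUND oriented tubular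
neighbourhood (`dottedTube`): in the stereographic chart `(ℝ × ℝ) × ℝ` of `GaussDiagramsChart`
it is the cylindrical-coordinate map
`(θ, w) ↦ (((R_j + s₀) cos θ, (R_j + s₀) sin θ), s₁)`, `s = squeeze ½ w`
(`cylPt`, `dottedTubeCoe`), lifted to `𝕊¹ × ℝ² → 𝕊³` by the tree's `periodicLift` and oriented by
`Knot.TubularNbhd.ofLocalDiffeomorph` (so the tube is this map or its fibre reflection,
`dottedTube_apply_or`).  Its image is the open round solid torus of tube radius `½` about `U_j`
(`stereo_dottedTube_mem`), so the tubes of distinct dotted circles are disjoint and all of them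
miss the picture `toSphereThree (draw k (M_k ∖ {cores}))`, which lies at tube distance `> 1`
from every `U_j`.  Finally the tube has FRAMING `0` (`hasFraming_dottedTube`): its longitude is a
coaxial horizontal circle of radius `R_j + 1/(2√5) > R_j`, the image of a circle of `ℝ³` under the
continuous map `q ↦ toSphereThree (q₀, q₁, q₂² + R₀² − q₀² − q₁²)` into the complement of `U_j`
(a paraboloid cap over the flat disc), hence null-homotopic there — the pattern of the tree's
`hasFraming_unknotTube` (`DehnSurgeryUnknotZeroProofs.lean`).  These tubes are the "round `0`-framed
tubes of the dotted unlink" to which an arbitrary surgery presentation along the picture link is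
transported (tubular-neighbourhood uniqueness, `Link.exists_diffeomorph_eq_of_hasFraming`) in the
proof of `pictureSurgeryPresentation`.

## References

* R. Kirby, *The Topology of 4-Manifolds*, LNM 1374 (1989), Ch. I §2 (dotted circles; Lemma 2.1).
  [Kirby1989]
* C. Manolescu, M. Marengon, S. Sarkar, M. Willis, Duke Math. J. 172 (2023), Def. 8.26,
  Remark 8.27 (the standard picture). [ManolescuMarengonSarkarWillis2023]
* D. Rolfsen, *Knots and Links* (1976), §9.G Example 3 (the `0`-framed longitude of an unknot
  bounds a disc in the exterior). [Rolfsen1976]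
-/

open scoped Manifold ContDiff Topology Real
open Function Set

noncomputable section

namespace Literature.Topology.FourManifolds

/-- Local notation: `𝔼 n` is the model Euclidean space `EuclideanSpace ℝ (Fin n)`. -/
local notation "𝔼 " n:arg => EuclideanSpace ℝ (Fin n)

/-- Local notation: `𝕊 n` is the unit sphere in `EuclideanSpace ℝ (Fin (n + 1))`. -/
local notation "𝕊 " n:arg => (Metric.sphere (0 : EuclideanSpace ℝ (Fin (n + 1))) 1)

/-- Local notation for the model with corners of `𝕊¹ × ℝ²`. -/
local notation "𝓘₁₂" => (ModelWithCorners.prod (𝓡 1) 𝓘(ℝ, EuclideanSpace ℝ (Fin 2)))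

attribute [local instance] fact_finrank_euclideanSpace_two fact_finrank_euclideanSpace_four

namespace MMSW

open Literature.AlgebraicTopology.Homotopy.HopfFibration (zC wC)

variable {k : ℕ}

/-! ## The dotted circles of the standard picture -/

/-- The planar radius `R_j = c_j + C_k = 4(j+1) + drawRadius k` of the `j`-th dotted circle of the
standard picture of `M_k` (the `j`-th hole centre pushed out by the offset of the axis of
revolution). [cite: Kirby1989, Ch. I §2] -/
def dottedRadius (k : ℕ) (j : Fin k) : ℝ :=
  4 * (((j : ℕ) : ℝ) + 1) + drawRadius k

/-- `R_j ≥ 104`. [folklore] -/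
theorem le_dottedRadius (j : Fin k) : (104 : ℝ) ≤ dottedRadius k j := by
  have hj : (0 : ℝ) ≤ ((j : ℕ) : ℝ) := Nat.cast_nonneg _
  have hk : (0 : ℝ) ≤ (k : ℝ) := Nat.cast_nonneg _
  rw [dottedRadius, drawRadius]
  nlinarith

/-- `R_j > 0`. [folklore] -/
theorem dottedRadius_pos (j : Fin k) : 0 < dottedRadius k j :=
  lt_of_lt_of_le (by norm_num) (le_dottedRadius j)

/-- Distinct dotted circles have radii at distance `≥ 4`. [folklore] -/
theorem four_le_abs_dottedRadius_sub {i j : Fin k} (hij : i ≠ j) :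
    (4 : ℝ) ≤ |dottedRadius k i - dottedRadius k j| := by
  have hne : (i : ℕ) ≠ (j : ℕ) := fun h ↦ hij (Fin.ext h)
  have h1 : (1 : ℝ) ≤ |((i : ℕ) : ℝ) - ((j : ℕ) : ℝ)| := by
    rcases lt_or_gt_of_ne hne with h | h
    · have h' : ((i : ℕ) : ℝ) + 1 ≤ ((j : ℕ) : ℝ) := by exact_mod_cast h
      rw [abs_of_neg (by linarith)]
      linarith
    · have h' : ((j : ℕ) : ℝ) + 1 ≤ ((i : ℕ) : ℝ) := by exact_mod_cast h
      rw [abs_of_pos (by linarith)]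
      linarith
  have : dottedRadius k i - dottedRadius k j = 4 * (((i : ℕ) : ℝ) - ((j : ℕ) : ℝ)) := by
    simp only [dottedRadius]; ring
  rw [this, abs_mul, abs_of_pos (by norm_num : (0 : ℝ) < 4)]
  linarith

/-- **The `j`-th dotted circle** `U_j` of the standard picture: the round horizontal circle of
planar radius `R_j` at height `0`, placed in `𝕊³` by the inverse stereographic map
`toSphereThree` — literally the `j`-th component prescribed in `pictureSurgeryPresentation`.
[cite: Kirby1989, Ch. I §2] -/
def dottedCircle (k : ℕ) (j : Fin k) (θ : 𝕊 1) : 𝕊 3 :=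
  toSphereThree (dottedRadius k j * (θ : 𝔼 2) 0, dottedRadius k j * (θ : 𝔼 2) 1) 0

/-- `dottedCircle` is the lambda written in `pictureSurgeryPresentation`. [folklore] -/
theorem dottedCircle_eq (k : ℕ) (j : Fin k) : dottedCircle k j = fun θ : 𝕊 1 ↦
    toSphereThree ((4 * (((j : ℕ) : ℝ) + 1) + drawRadius k) * (θ : 𝔼 2) 0,
      (4 * (((j : ℕ) : ℝ) + 1) + drawRadius k) * (θ : 𝔼 2) 1) 0 :=
  rfl

/-- The dotted circle over an angle, in the chart: `((R cos t, R sin t), 0)`. [folklore] -/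
theorem dottedCircle_circlePoint (j : Fin k) (t : ℝ) : dottedCircle k j (circlePoint t) =
    stereoNorthInv ((dottedRadius k j * Real.cos t, dottedRadius k j * Real.sin t), 0) := by
  rw [dottedCircle, circlePoint_apply_zero, circlePoint_apply_one]
  exact toSphereThree_eq_stereoNorthInv ((_, _), (0 : ℝ))

/-! ## Cylindrical coordinates about a horizontal circle -/

/-- **Cylindrical coordinates about the horizontal circle of radius `R` at height `0`**, in the
stereographic chart `(ℝ × ℝ) × ℝ`: `(θ, (a, b)) ↦ (((R + a) cos θ, (R + a) sin θ), b)` — planar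
radius `R + a`, planar angle `θ`, height `b`. [folklore] -/
def cylPt (R : ℝ) (q : ℝ × 𝔼 2) : (ℝ × ℝ) × ℝ :=
  (((R + q.2 0) * Real.cos q.1, (R + q.2 0) * Real.sin q.1), q.2 1)

/-- `cylPt` is smooth. [folklore] -/
theorem contDiff_cylPt (R : ℝ) : ContDiff ℝ ∞ (cylPt R) := by
  have h0 : ContDiff ℝ ∞ fun q : ℝ × 𝔼 2 ↦ q.2 0 := (contDiff_euclidean.1 contDiff_snd 0)
  have h1 : ContDiff ℝ ∞ fun q : ℝ × 𝔼 2 ↦ q.2 1 := (contDiff_euclidean.1 contDiff_snd 1)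
  unfold cylPt
  exact (((contDiff_const.add h0).mul (Real.contDiff_cos.comp contDiff_fst)).prodMk
    ((contDiff_const.add h0).mul (Real.contDiff_sin.comp contDiff_fst))).prodMk h1

/-- `cylPt` is `2π`-periodic in the angle. [folklore] -/
theorem cylPt_add_two_pi (R θ : ℝ) (v : 𝔼 2) : cylPt R (θ + 2 * π, v) = cylPt R (θ, v) := by
  simp [cylPt, Real.cos_add_two_pi, Real.sin_add_two_pi]

/-- The planar point of `cylPt R (θ, v)` as a complex number has norm `R + v₀` when
`R + v₀ ≥ 0`. [folklore] -/
theorem norm_chartC_cylPt {R : ℝ} {q : ℝ × 𝔼 2} (h : 0 ≤ R + q.2 0) :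
    ‖chartC (cylPt R q)‖ = R + q.2 0 := by
  have hsq : Complex.normSq (chartC (cylPt R q)) = (R + q.2 0) ^ 2 := by
    have hcs := Real.sin_sq_add_cos_sq q.1
    simp only [Complex.normSq_apply, chartC_re, chartC_im, cylPt]
    nlinarith
  rw [Complex.norm_def, hsq, Real.sqrt_sq h]


/-- The height of `cylPt R (θ, v)` is `v₁`. [folklore] -/
@[simp] theorem cylPt_snd (R : ℝ) (q : ℝ × 𝔼 2) : (cylPt R q).2 = q.2 1 := rfl

/-! ## The thin round tube in `ℝ⁴` and on the manifold -/

/-- **The thin round tube about `U_j` in `ℝ⁴`**: `(θ, w) ↦ toSphereThree (cylPt R_j (θ, σ w))` with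
`σ = squeeze ½` the radial diffeomorphism of `ℝ²` onto the open disc of radius `½`. [folklore] -/
def dottedTubeCoe (k : ℕ) (j : Fin k) (q : ℝ × 𝔼 2) : 𝔼 4 :=
  stereoNorthInvCoe (cylPt (dottedRadius k j) (q.1, squeeze (1 / 2) q.2))

/-- The thin round tube is smooth. [folklore] -/
theorem contDiff_dottedTubeCoe (j : Fin k) : ContDiff ℝ ∞ (dottedTubeCoe k j) :=
  contDiff_stereoNorthInvCoe.comp ((contDiff_cylPt _).comp
    (contDiff_fst.prodMk ((contDiff_squeeze _).comp contDiff_snd)))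

/-- The thin round tube is `2π`-periodic in the angle. [folklore] -/
theorem dottedTubeCoe_add_two_pi (j : Fin k) (θ : ℝ) (w : 𝔼 2) :
    dottedTubeCoe k j (θ + 2 * π, w) = dottedTubeCoe k j (θ, w) := by
  simp only [dottedTubeCoe, cylPt_add_two_pi]

/-- The thin round tube takes values on the unit sphere. [folklore] -/
theorem norm_dottedTubeCoe (j : Fin k) (q : ℝ × 𝔼 2) : ‖dottedTubeCoe k j q‖ = 1 :=
  norm_stereoNorthInvCoe _

/-- In the tube, the planar radius `R_j + (σ w)₀` is `> 103`. [folklore] -/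
theorem dottedRadius_add_squeeze_pos (j : Fin k) (w : 𝔼 2) :
    0 < dottedRadius k j + squeeze (1 / 2) w 0 := by
  have hle : |squeeze (1 / 2) w 0| ≤ ‖squeeze (1 / 2) w‖ := by
    rw [EuclideanSpace.norm_eq]
    refine Real.abs_le_sqrt ?_
    exact Finset.single_le_sum (f := fun i : Fin 2 ↦ ‖squeeze (1 / 2) w i‖ ^ 2)
      (fun i _ ↦ by positivity) (Finset.mem_univ 0) |>.trans_eq' (by simp [sq_abs])
  have h1 : |squeeze (1 / 2) w 0| < 1 / 2 := lt_of_le_of_lt hle (norm_squeeze_lt (by norm_num) w)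
  have h2 := le_dottedRadius j
  have h3 := neg_abs_le (squeeze (1 / 2) w 0)
  linarith

/-- **The thin round tube of `U_j` on the manifold** `𝕊¹ × ℝ² → 𝕊³` (the tree's `periodicLift` of
`dottedTubeCoe`). [folklore] -/
def dottedTubeFun (k : ℕ) (j : Fin k) : (𝕊 1) × 𝔼 2 → 𝕊 3 :=
  periodicLift (dottedTubeCoe k j) (norm_dottedTubeCoe j)

/-- The thin round tube over an angle: `toSphereThree (cylPt R_j (t, σ w))`. [folklore] -/
theorem dottedTubeFun_circlePoint (j : Fin k) (t : ℝ) (w : 𝔼 2) :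
    dottedTubeFun k j (circlePoint t, w) =
      stereoNorthInv (cylPt (dottedRadius k j) (t, squeeze (1 / 2) w)) :=
  Subtype.ext (coe_periodicLift_circlePoint (dottedTubeCoe_add_two_pi j) (norm_dottedTubeCoe j) t w)

/-- The thin round tube is smooth. [folklore] -/
theorem contMDiff_dottedTubeFun (j : Fin k) : ContMDiff 𝓘₁₂ (𝓡 3) ∞ (dottedTubeFun k j) :=
  contMDiff_periodicLift (contDiff_dottedTubeCoe j) (dottedTubeCoe_add_two_pi j) (norm_dottedTubeCoe j)

/-- **The zero section of the thin round tube is the dotted circle.** [folklore] -/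
theorem dottedTubeFun_zero (j : Fin k) (u : 𝕊 1) : dottedTubeFun k j (u, 0) = dottedCircle k j u := by
  obtain ⟨t, rfl⟩ := circlePoint_surjective u
  rw [dottedTubeFun_circlePoint, dottedCircle_circlePoint, squeeze_zero]
  simp [cylPt]

/-- The stereographic coordinates of a point of the thin round tube. [folklore] -/
theorem stereoNorthCoords_dottedTubeFun (j : Fin k) (t : ℝ) (w : 𝔼 2) :
    stereoNorthCoords ((dottedTubeFun k j (circlePoint t, w) : 𝕊 3) : 𝔼 4) =
      cylPt (dottedRadius k j) (t, squeeze (1 / 2) w) := by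
  rw [dottedTubeFun_circlePoint, coe_stereoNorthInv, stereoNorthCoords_stereoNorthInvCoe]

/-! ## Injectivity of the thin round tube -/

/-- Two angles with the same cosine and sine give the same point of the circle. [folklore] -/
theorem circlePoint_eq_of_cos_eq_of_sin_eq {s t : ℝ} (hc : Real.cos s = Real.cos t)
    (hs : Real.sin s = Real.sin t) : circlePoint s = circlePoint t := by
  apply Subtype.ext
  ext i
  fin_cases i
  · simpa using hc
  · simpa using hs


/-- **The thin round tube is injective**: planar radius, planar angle and height are read off the
stereographic coordinates. [folklore] -/
theorem dottedTubeFun_injective (j : Fin k) : Injective (dottedTubeFun k j) := by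
  rintro ⟨u, w⟩ ⟨u', w'⟩ h
  obtain ⟨t, rfl⟩ := circlePoint_surjective u
  obtain ⟨t', rfl⟩ := circlePoint_surjective u'
  have hc := congrArg (fun x : 𝕊 3 ↦ stereoNorthCoords (x : 𝔼 4)) h
  simp only [stereoNorthCoords_dottedTubeFun] at hc
  set R := dottedRadius k j
  set s := squeeze (1 / 2) w
  set s' := squeeze (1 / 2) w'
  have hA : 0 < R + s 0 := dottedRadius_add_squeeze_pos j w
  have hA' : 0 < R + s' 0 := dottedRadius_add_squeeze_pos j w'
  -- heights
  have h1 : s 1 = s' 1 := by simpa [cylPt] using congrArg Prod.snd hc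
  -- planar radii
  have hn := congrArg (fun y ↦ ‖chartC y‖) hc
  rw [norm_chartC_cylPt (R := R) (q := (t, s)) hA.le, norm_chartC_cylPt (R := R) (q := (t', s')) hA'.le]
    at hn
  have h0 : s 0 = s' 0 := by simpa using hn
  have hs : s = s' := by
    ext i
    fin_cases i
    · exact h0
    · exact h1
  have hw : w = w' := squeeze_injective (by norm_num) hs
  -- planar angles
  have hp := congrArg Prod.fst hc
  simp only [cylPt, Prod.mk.injEq] at hp
  rw [h0] at hp
  have hcos : Real.cos t = Real.cos t' := mul_left_cancel₀ hA'.ne' hp.1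
  have hsin : Real.sin t = Real.sin t' := mul_left_cancel₀ hA'.ne' hp.2
  rw [circlePoint_eq_of_cos_eq_of_sin_eq hcos hsin, hw]

/-! ## The differential of the thin round tube is injective -/

/-- The differential of the squeeze map is injective (its Jacobian is positive). [folklore] -/
theorem squeezeFDeriv_injective {δ : ℝ} (hδ : 0 < δ) (w : 𝔼 2) : Injective (squeezeFDeriv δ w) := by
  refine (injective_iff_map_eq_zero _).2 fun d hd ↦ ?_
  rw [squeezeFDeriv_apply] at hd
  have h := congrArg (fun v : 𝔼 2 ↦ inner ℝ d v) hd
  simp only [inner_add_right, inner_smul_right, inner_zero_right, real_inner_self_eq_norm_sq] at h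
  have hρ := squeezeFactor_pos w
  have hρ2 := squeezeFactor_sq_mul w
  have hcs : inner ℝ d w ^ 2 ≤ ‖d‖ ^ 2 * ‖w‖ ^ 2 := by
    have := abs_real_inner_le_norm d w
    nlinarith [abs_nonneg (inner ℝ d w), sq_abs (inner ℝ d w)]
  have hwd : inner ℝ w d = inner ℝ d w := real_inner_comm _ _
  rw [hwd] at h
  -- `δ ρ ‖d‖² = δ ρ³ ⟨d, w⟩²`, hence `‖d‖² ≤ ρ² ‖w‖² ‖d‖² < ‖d‖²` unless `d = 0`
  have hkey : ‖d‖ ^ 2 = squeezeFactor w ^ 2 * inner ℝ d w ^ 2 := by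
    have hδρ : δ * squeezeFactor w ≠ 0 := (mul_pos hδ hρ).ne'
    have : δ * squeezeFactor w * (‖d‖ ^ 2 - squeezeFactor w ^ 2 * inner ℝ d w ^ 2) = 0 := by
      linear_combination h
    have := (mul_eq_zero.1 this).resolve_left hδρ
    linarith
  have hd0 : ‖d‖ ^ 2 = 0 := by
    nlinarith [sq_nonneg ‖d‖, sq_nonneg ‖w‖, mul_nonneg (sq_nonneg (squeezeFactor w)) (sq_nonneg ‖d‖)]
  exact norm_eq_zero.1 (pow_eq_zero_iff two_ne_zero |>.1 hd0)

section Derivative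

variable (R : ℝ) (t : ℝ) (v : 𝔼 2)

/-- The directional derivative of `cylPt R` as a derivative along a line. [folklore] -/
theorem fderiv_cylPt_apply (e : ℝ × 𝔼 2) :
    fderiv ℝ (cylPt R) (t, v) e = deriv (fun s : ℝ ↦ cylPt R ((t, v) + s • e)) 0 := by
  have hd : DifferentiableAt ℝ (cylPt R) ((t, v) + (0 : ℝ) • e) := by
    rw [zero_smul, add_zero]
    exact (contDiff_cylPt R).differentiable (by simp) _
  have hline : HasDerivAt (fun s : ℝ ↦ (t, v) + s • e) e 0 := by
    simpa using ((hasDerivAt_id (0 : ℝ)).smul_const e).const_add (t, v)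
  have h := hd.hasFDerivAt.comp_hasDerivAt (0 : ℝ) hline
  rw [zero_smul, add_zero] at h
  exact h.deriv.symm

/-- `∂_θ cylPt R (t, v) = ((-(R + v₀) sin t, (R + v₀) cos t), 0)`. [folklore] -/
theorem fderiv_cylPt_angle : fderiv ℝ (cylPt R) (t, v) (1, 0) =
    ((-((R + v 0) * Real.sin t), (R + v 0) * Real.cos t), 0) := by
  rw [fderiv_cylPt_apply]
  have hfun : (fun s : ℝ ↦ cylPt R ((t, v) + s • ((1 : ℝ), (0 : 𝔼 2)))) =
      fun s ↦ (((R + v 0) * Real.cos (t + s), (R + v 0) * Real.sin (t + s)), v 1) := by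
    funext s
    simp [cylPt]
  rw [hfun]
  have hc : HasDerivAt (fun s : ℝ ↦ (R + v 0) * Real.cos (t + s)) (-((R + v 0) * Real.sin t)) 0 := by
    have := ((Real.hasDerivAt_cos (t + 0)).comp_const_add t 0).const_mul (R + v 0)
    simpa using this
  have hs : HasDerivAt (fun s : ℝ ↦ (R + v 0) * Real.sin (t + s)) ((R + v 0) * Real.cos t) 0 := by
    have := ((Real.hasDerivAt_sin (t + 0)).comp_const_add t 0).const_mul (R + v 0)
    simpa using this
  exact ((hc.prodMk hs).prodMk (hasDerivAt_const (0 : ℝ) (v 1))).deriv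

/-- `∂_{w₀} cylPt R (t, v) = ((cos t, sin t), 0)`. [folklore] -/
theorem fderiv_cylPt_single_zero : fderiv ℝ (cylPt R) (t, v) (0, EuclideanSpace.single 0 1) =
    ((Real.cos t, Real.sin t), 0) := by
  rw [fderiv_cylPt_apply]
  have hfun : (fun s : ℝ ↦ cylPt R ((t, v) + s • ((0 : ℝ), EuclideanSpace.single (0 : Fin 2) (1 : ℝ)))) =
      fun s ↦ (((R + v 0 + s) * Real.cos t, (R + v 0 + s) * Real.sin t), v 1) := by
    funext s
    simp [cylPt, add_assoc]
  rw [hfun]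
  have h0 : HasDerivAt (fun s : ℝ ↦ R + v 0 + s) 1 0 := (hasDerivAt_id (0 : ℝ)).const_add _
  have hc : HasDerivAt (fun s : ℝ ↦ (R + v 0 + s) * Real.cos t) (Real.cos t) 0 := by
    simpa using h0.mul_const (Real.cos t)
  have hs : HasDerivAt (fun s : ℝ ↦ (R + v 0 + s) * Real.sin t) (Real.sin t) 0 := by
    simpa using h0.mul_const (Real.sin t)
  exact ((hc.prodMk hs).prodMk (hasDerivAt_const (0 : ℝ) (v 1))).deriv

/-- `∂_{w₁} cylPt R (t, v) = ((0, 0), 1)`. [folklore] -/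
theorem fderiv_cylPt_single_one : fderiv ℝ (cylPt R) (t, v) (0, EuclideanSpace.single 1 1) =
    ((0, 0), 1) := by
  rw [fderiv_cylPt_apply]
  have hfun : (fun s : ℝ ↦ cylPt R ((t, v) + s • ((0 : ℝ), EuclideanSpace.single (1 : Fin 2) (1 : ℝ)))) =
      fun s ↦ (((R + v 0) * Real.cos t, (R + v 0) * Real.sin t), v 1 + s) := by
    funext s
    simp [cylPt]
  rw [hfun]
  exact (((hasDerivAt_const (0 : ℝ) _).prodMk (hasDerivAt_const (0 : ℝ) _)).prodMk
    ((hasDerivAt_id (0 : ℝ)).const_add (v 1))).deriv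

/-- Decomposition of a vector of `ℝ × ℝ²` along the coordinate directions. [folklore] -/
theorem prod_euclideanTwo_decomp (e : ℝ × 𝔼 2) : e = e.1 • ((1 : ℝ), (0 : 𝔼 2)) +
    e.2 0 • ((0 : ℝ), EuclideanSpace.single (0 : Fin 2) (1 : ℝ)) +
    e.2 1 • ((0 : ℝ), EuclideanSpace.single (1 : Fin 2) (1 : ℝ)) := by
  obtain ⟨a, h⟩ := e
  refine Prod.ext (by simp) ?_
  simp only [Prod.snd_add, Prod.smul_snd, smul_zero, zero_add]
  ext i
  fin_cases i <;> simp

/-- **The differential of `cylPt R` is injective** off the axis `R + v₀ = 0`. [folklore] -/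
theorem fderiv_cylPt_injective (hA : R + v 0 ≠ 0) : Injective (fderiv ℝ (cylPt R) (t, v)) := by
  refine (injective_iff_map_eq_zero _).2 fun e he ↦ ?_
  rw [prod_euclideanTwo_decomp e, map_add, map_add, map_smul, map_smul, map_smul, fderiv_cylPt_angle,
    fderiv_cylPt_single_zero, fderiv_cylPt_single_one] at he
  simp only [Prod.smul_mk, smul_eq_mul, mul_zero, Prod.mk_add_mk, add_zero, zero_add, mul_one,
    Prod.mk_eq_zero] at he
  obtain ⟨⟨hx, hy⟩, h1⟩ := he
  have hcs := Real.sin_sq_add_cos_sq t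
  -- rotate the planar equations
  have h0 : e.2 0 = 0 := by
    have : e.2 0 * (Real.sin t ^ 2 + Real.cos t ^ 2) = 0 := by linear_combination Real.cos t * hx + Real.sin t * hy
    simpa [hcs] using this
  have ha : e.1 = 0 := by
    have : e.1 * (R + v 0) * (Real.sin t ^ 2 + Real.cos t ^ 2) = 0 := by
      linear_combination (-Real.sin t) * hx + Real.cos t * hy
    rw [hcs, mul_one] at this
    exact (mul_eq_zero.1 this).resolve_right hA
  rw [prod_euclideanTwo_decomp e, ha, h0, h1]
  simp

end Derivative

/-- **The differential of the thin round tube is injective** (chain rule: inverse stereographic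
map, cylindrical coordinates and squeeze all have injective differentials). [folklore] -/
theorem fderiv_dottedTubeCoe_injective (j : Fin k) (q : ℝ × 𝔼 2) :
    Injective (fderiv ℝ (dottedTubeCoe k j) q) := by
  obtain ⟨t, w⟩ := q
  set R := dottedRadius k j
  set G : ℝ × 𝔼 2 → 𝔼 4 := stereoNorthInvCoe ∘ cylPt R with hG
  have hGd : Differentiable ℝ G :=
    differentiable_stereoNorthInvCoe.comp ((contDiff_cylPt R).differentiable (by simp))
  have hfun : dottedTubeCoe k j = fun q : ℝ × 𝔼 2 ↦ G (q.1, squeeze (1 / 2) q.2) := rfl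
  rw [hfun, (hasFDerivAt_comp_squeeze hGd (1 / 2) t w).fderiv]
  -- the three factors
  have h1 : Injective (fderiv ℝ G (t, squeeze (1 / 2) w)) := by
    rw [hG, fderiv_comp _ (differentiable_stereoNorthInvCoe _)
      ((contDiff_cylPt R).differentiable (by simp) _)]
    exact (fderiv_stereoNorthInvCoe_injective _).comp
      (fderiv_cylPt_injective R t _ (dottedRadius_add_squeeze_pos j w).ne')
  have h2 : Injective ((ContinuousLinearMap.fst ℝ ℝ (𝔼 2)).prod
      ((squeezeFDeriv (1 / 2) w).comp (ContinuousLinearMap.snd ℝ ℝ (𝔼 2)))) := by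
    rintro ⟨a, h⟩ ⟨a', h'⟩ he
    simp only [ContinuousLinearMap.prod_apply, ContinuousLinearMap.coe_fst', ContinuousLinearMap.coe_comp,
      ContinuousLinearMap.coe_snd', comp_apply, Prod.mk.injEq] at he
    exact Prod.ext he.1 (squeezeFDeriv_injective (by norm_num) w he.2)
  exact h1.comp h2

/-- **The thin round tube is a local diffeomorphism** `𝕊¹ × ℝ² → 𝕊³`. [folklore] -/
theorem isLocalDiffeomorph_dottedTubeFun (j : Fin k) :
    IsLocalDiffeomorph 𝓘₁₂ (𝓡 3) ∞ (dottedTubeFun k j) := fun _ ↦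
  isLocalDiffeomorphAt_periodicLift (contDiff_dottedTubeCoe j) (dottedTubeCoe_add_two_pi j)
    (norm_dottedTubeCoe j) fun t _ ↦ fderiv_dottedTubeCoe_injective j (t, _)

/-! ## The oriented thin round tube of a dotted circle -/

/-- **The thin round oriented tubular neighbourhood of the `j`-th dotted circle**, for any knot `K`
whose underlying map is `dottedCircle k j` (as for the components of the picture link of
`pictureSurgeryPresentation`): the thin round tube or its fibre reflection, whichever is positively
oriented (`Knot.TubularNbhd.ofLocalDiffeomorph`). [cite: Kirby1989, Ch. I §2] -/
def dottedTube (j : Fin k) (K : Knot) (hK : ⇑K = dottedCircle k j) : Knot.TubularNbhd K :=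
  Knot.TubularNbhd.ofLocalDiffeomorph (isLocalDiffeomorph_dottedTubeFun j) (dottedTubeFun_injective j)
    fun x ↦ by rw [hK]; exact dottedTubeFun_zero j x

/-- The oriented thin tube is the thin round tube or its fibre reflection. [folklore] -/
theorem dottedTube_apply_or (j : Fin k) (K : Knot) (hK : ⇑K = dottedCircle k j) :
    (∀ q, dottedTube j K hK q = dottedTubeFun k j q) ∨
      ∀ q, dottedTube j K hK q = dottedTubeFun k j (q.1, planeFlip q.2) :=
  Knot.TubularNbhd.ofLocalDiffeomorph_apply_or _ _ _

/-- Every value of the oriented thin tube is a value of the thin round tube. [folklore] -/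
theorem exists_dottedTube_eq (j : Fin k) (K : Knot) (hK : ⇑K = dottedCircle k j)
    (q : (𝕊 1) × 𝔼 2) : ∃ q' : (𝕊 1) × 𝔼 2, q'.1 = q.1 ∧ ‖q'.2‖ = ‖q.2‖ ∧
      dottedTube j K hK q = dottedTubeFun k j q' := by
  rcases dottedTube_apply_or j K hK with h | h
  · exact ⟨q, rfl, rfl, h q⟩
  · exact ⟨(q.1, planeFlip q.2), rfl, norm_planeFlip q.2, h q⟩

/-- The image of the oriented thin tube lies in that of the thin round tube. [folklore] -/
theorem range_dottedTube_subset (j : Fin k) (K : Knot) (hK : ⇑K = dottedCircle k j) :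
    range (dottedTube j K hK) ⊆ range (dottedTubeFun k j) := by
  rintro _ ⟨q, rfl⟩
  obtain ⟨q', -, -, h⟩ := exists_dottedTube_eq j K hK q
  exact ⟨q', h.symm⟩

/-! ## Where the thin tubes lie: the open solid torus of tube radius `½` about `U_j` -/

/-- **A point of the thin round tube is at tube distance `< ½` from `U_j`** in the stereographic
chart: `(|P| - R_j)² + h² < ¼` for its planar point `P` and height `h`. [folklore] -/
theorem tubeDistSq_dottedTubeFun_lt (j : Fin k) (q : (𝕊 1) × 𝔼 2) :
    (‖chartC (stereoNorthCoords ((dottedTubeFun k j q : 𝕊 3) : 𝔼 4))‖ - dottedRadius k j) ^ 2 +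
      (stereoNorthCoords ((dottedTubeFun k j q : 𝕊 3) : 𝔼 4)).2 ^ 2 < 1 / 4 := by
  obtain ⟨u, w⟩ := q
  obtain ⟨t, rfl⟩ := circlePoint_surjective u
  rw [stereoNorthCoords_dottedTubeFun, norm_chartC_cylPt (dottedRadius_add_squeeze_pos j w).le,
    cylPt_snd]
  have hn := norm_squeeze_lt (δ := 1 / 2) (by norm_num) w
  have hsq : ‖squeeze (1 / 2) w‖ ^ 2 = squeeze (1 / 2) w 0 ^ 2 + squeeze (1 / 2) w 1 ^ 2 := by
    rw [EuclideanSpace.norm_eq, Real.sq_sqrt (by positivity), Fin.sum_univ_two]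
    simp [sq_abs]
  have h4 : ‖squeeze (1 / 2) w‖ ^ 2 < 1 / 4 := by
    have h0 := norm_nonneg (squeeze (1 / 2) w)
    nlinarith
  simp only [add_sub_cancel_left]
  linarith

/-- The thin round tube misses the north pole. [folklore] -/
theorem dottedTubeFun_ne_northPole (j : Fin k) (q : (𝕊 1) × 𝔼 2) : dottedTubeFun k j q ≠ northPole := by
  obtain ⟨u, w⟩ := q
  obtain ⟨t, rfl⟩ := circlePoint_surjective u
  rw [dottedTubeFun_circlePoint]
  exact stereoNorthInv_ne_northPole _

/-- **The thin tubes of distinct dotted circles are disjoint** (their tube radii are `½` and the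
circles are coaxial at distance `≥ 4`). [folklore] -/
theorem disjoint_range_dottedTubeFun {i j : Fin k} (hij : i ≠ j) :
    Disjoint (range (dottedTubeFun k i)) (range (dottedTubeFun k j)) := by
  refine Set.disjoint_left.2 ?_
  rintro _ ⟨q, rfl⟩ ⟨q', hq'⟩
  have hi := tubeDistSq_dottedTubeFun_lt i q
  have hj := tubeDistSq_dottedTubeFun_lt j q'
  rw [hq'] at hj
  set ρ := ‖chartC (stereoNorthCoords ((dottedTubeFun k i q : 𝕊 3) : 𝔼 4))‖
  set h := (stereoNorthCoords ((dottedTubeFun k i q : 𝕊 3) : 𝔼 4)).2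
  have h4 := four_le_abs_dottedRadius_sub hij
  have ha : |ρ - dottedRadius k i| < 1 / 2 := abs_lt_of_sq_lt_sq' (by nlinarith) (by norm_num) |>.2 |>
    fun h2 ↦ abs_lt.2 ⟨(abs_lt_of_sq_lt_sq' (by nlinarith) (by norm_num)).1, h2⟩
  have hb : |ρ - dottedRadius k j| < 1 / 2 := abs_lt_of_sq_lt_sq' (by nlinarith) (by norm_num) |>.2 |>
    fun h2 ↦ abs_lt.2 ⟨(abs_lt_of_sq_lt_sq' (by nlinarith) (by norm_num)).1, h2⟩
  have := abs_sub_abs_le_abs_sub (ρ - dottedRadius k j) (ρ - dottedRadius k i)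
  have h' : |dottedRadius k i - dottedRadius k j| ≤ |ρ - dottedRadius k j| + |ρ - dottedRadius k i| := by
    calc |dottedRadius k i - dottedRadius k j| = |(ρ - dottedRadius k j) - (ρ - dottedRadius k i)| := by ring_nf
      _ ≤ |ρ - dottedRadius k j| + |ρ - dottedRadius k i| := abs_sub _ _
  linarith

/-- **The thin tubes miss the standard picture**: a point `x ∈ M_k` off the cores is drawn at tube
distance `|z - c_j| ≥ 1` from `U_j` (`(|P| - R_j)² + h² = (Re z - c_j)² + (Im z)²`). [folklore] -/
theorem approxMap_zero_notMem_range_dottedTubeFun (j : Fin k) {x : 𝔼 4} (hx : x ∈ modelBoundary k)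
    (hw : wC x ≠ 0) : approxMap k 0 x ∉ range (dottedTubeFun k j) := by
  rintro ⟨q, hq⟩
  have hlt := tubeDistSq_dottedTubeFun_lt j q
  rw [hq] at hlt
  have hco : stereoNorthCoords ((approxMap k 0 x : 𝕊 3) : 𝔼 4) = draw k x := by
    rw [← stereoNorthInvCoe_draw, stereoNorthCoords_stereoNorthInvCoe]
  rw [hco, chartC_draw, norm_drawC hw (re_zC_add_drawRadius_pos hx)] at hlt
  have hh : (draw k x).2 = (zC x).im := rfl
  rw [hh] at hlt
  have hguard := hx.1 j
  rw [holeTerm] at hguard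
  have hre : (zC x).re = x 0 := rfl
  have him : (zC x).im = x 1 := rfl
  rw [hre, him, dottedRadius] at hlt
  nlinarith

/-! ## The thin tube of a dotted circle has framing `0` -/

/-- On the base vector `e₀ = (½, 0)` the oriented thin tube is the thin round tube (the fibre
reflection fixes `e₀`). [folklore] -/
theorem dottedTube_apply_framingBaseVector (j : Fin k) (K : Knot) (hK : ⇑K = dottedCircle k j)
    (u : 𝕊 1) : dottedTube j K hK (u, framingBaseVector) = dottedTubeFun k j (u, framingBaseVector) := by
  rcases dottedTube_apply_or j K hK with h | h
  · exact h _
  · rw [h, planeFlip_framingBaseVector]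

/-- The second coordinate of the squeezed base vector vanishes. [folklore] -/
theorem squeeze_framingBaseVector_apply_one : squeeze (1 / 2) framingBaseVector 1 = 0 := by
  simp [squeeze_def, framingBaseVector]

/-- The first coordinate of the squeezed base vector is positive. [folklore] -/
theorem squeeze_framingBaseVector_apply_zero_pos : 0 < squeeze (1 / 2) framingBaseVector 0 := by
  have hρ := squeezeFactor_pos framingBaseVector
  simp only [squeeze_def, PiLp.smul_apply, smul_eq_mul, framingBaseVector, circlePoint_apply_zero,
    Real.cos_zero, mul_one]
  positivity

/-- The planar radius `R₀ = R_j + (σ e₀)₀ > R_j` of the longitude of the thin tube. [folklore] -/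
def longitudeRadius (k : ℕ) (j : Fin k) : ℝ :=
  dottedRadius k j + squeeze (1 / 2) framingBaseVector 0

/-- `R₀ > R_j`. [folklore] -/
theorem dottedRadius_lt_longitudeRadius (j : Fin k) : dottedRadius k j < longitudeRadius k j := by
  rw [longitudeRadius]
  linarith [squeeze_framingBaseVector_apply_zero_pos]

/-- **The longitude of the thin tube is the coaxial horizontal circle of radius `R₀`.**
[folklore] -/
theorem dottedTubeFun_circlePoint_framingBaseVector (j : Fin k) (t : ℝ) :
    dottedTubeFun k j (circlePoint t, framingBaseVector) =
      stereoNorthInv ((longitudeRadius k j * Real.cos t, longitudeRadius k j * Real.sin t), 0) := by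
  rw [dottedTubeFun_circlePoint, cylPt, squeeze_framingBaseVector_apply_one, longitudeRadius]

/-- **The cap map** `ℝ³ → 𝕊³`, `q ↦ toSphereThree ((q₀, q₁), q₂² + R₀² - q₀² - q₁²)`: a paraboloid
cap over the horizontal plane which carries the circle of radius `R₀` onto the longitude and
misses the dotted circle (of smaller radius `R_j` at height `0`). [folklore] -/
def capMap₃ (k : ℕ) (j : Fin k) (q : 𝔼 3) : 𝕊 3 :=
  stereoNorthInv ((q 0, q 1), q 2 ^ 2 + longitudeRadius k j ^ 2 - q 0 ^ 2 - q 1 ^ 2)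

/-- The cap map is continuous. [folklore] -/
theorem continuous_capMap₃ (j : Fin k) : Continuous (capMap₃ k j) := by
  unfold capMap₃
  fun_prop

/-- The circle `t ↦ (R₀ cos t, R₀ sin t, 0)` of `ℝ³`. [folklore] -/
def capCircle₃ (k : ℕ) (j : Fin k) (t : ℝ) : 𝔼 3 :=
  WithLp.toLp 2 ![longitudeRadius k j * Real.cos t, longitudeRadius k j * Real.sin t, 0]

/-- `capCircle₃` is continuous. [folklore] -/
theorem continuous_capCircle₃ (j : Fin k) : Continuous (capCircle₃ k j) := by
  unfold capCircle₃
  refine (PiLp.continuous_toLp 2 _).comp (continuous_pi fun i ↦ ?_)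
  fin_cases i <;> simp <;> fun_prop

/-- `capCircle₃` is `2π`-periodic at `0`. [folklore] -/
theorem capCircle₃_two_pi (j : Fin k) : capCircle₃ k j (2 * π) = capCircle₃ k j 0 := by
  simp [capCircle₃]

/-- **The cap map sends the circle onto the longitude of the thin tube.** [folklore] -/
theorem capMap₃_capCircle₃ (j : Fin k) (t : ℝ) :
    capMap₃ k j (capCircle₃ k j t) = dottedTubeFun k j (circlePoint t, framingBaseVector) := by
  rw [dottedTubeFun_circlePoint_framingBaseVector, capMap₃]
  have hcs := Real.sin_sq_add_cos_sq t
  congr 1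
  refine Prod.ext (by simp [capCircle₃]) ?_
  simp only [capCircle₃]
  simp
  nlinarith

/-- **The cap misses the dotted circle**: a point of the cap at height `0` has planar radius
`≥ R₀ > R_j`. [folklore] -/
theorem capMap₃_ne_dottedCircle (j : Fin k) (q : 𝔼 3) (u : 𝕊 1) : capMap₃ k j q ≠ dottedCircle k j u := by
  obtain ⟨τ, rfl⟩ := circlePoint_surjective u
  rw [dottedCircle_circlePoint, capMap₃]
  intro h
  have h' := stereoNorthInvCoe_injective (congrArg (fun x : 𝕊 3 ↦ (x : 𝔼 4)) h)
  simp only [Prod.mk.injEq] at h'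
  obtain ⟨⟨h0, h1⟩, h2⟩ := h'
  have hcs := Real.sin_sq_add_cos_sq τ
  have hlt := dottedRadius_lt_longitudeRadius j
  have hR := dottedRadius_pos j
  rw [h0, h1] at h2
  have hsq : (dottedRadius k j * Real.cos τ) ^ 2 + (dottedRadius k j * Real.sin τ) ^ 2 =
      dottedRadius k j ^ 2 := by
    rw [mul_pow, mul_pow, ← mul_add, add_comm, hcs, mul_one]
  nlinarith [sq_nonneg (q 2)]

/-- The base point `(R₀, 0, 0)` of the parameter space `ℝ³`. [folklore] -/
def capBase₃ (k : ℕ) (j : Fin k) : (univ : Set (𝔼 3)) := ⟨capCircle₃ k j 0, mem_univ _⟩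

/-- **The circle as a loop in the parameter space** based at `(R₀, 0, 0)`. [folklore] -/
def capLoop₃ (k : ℕ) (j : Fin k) : Path (capBase₃ k j) (capBase₃ k j) where
  toFun θ := ⟨capCircle₃ k j (2 * π * θ), mem_univ _⟩
  continuous_toFun :=
    ((continuous_capCircle₃ j).comp (continuous_const.mul continuous_subtype_val)).subtype_mk _
  source' := by
    apply Subtype.ext
    simp only [Set.Icc.coe_zero, mul_zero]
    rfl
  target' := by
    apply Subtype.ext
    simp only [Set.Icc.coe_one, mul_one, capCircle₃_two_pi]
    rfl

/-- **The circle is null-homotopic in the parameter space** (`ℝ³` is convex). [folklore] -/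
theorem capLoop₃_homotopic_refl (j : Fin k) : (capLoop₃ k j).Homotopic (Path.refl (capBase₃ k j)) := by
  haveI : ContractibleSpace (univ : Set (𝔼 3)) := convex_univ.contractibleSpace ⟨_, (capBase₃ k j).2⟩
  exact SimplyConnectedSpace.paths_homotopic _ _

section Framing

variable (j : Fin k) (K : Knot) (hK : ⇑K = dottedCircle k j)
include hK

/-- `capMap₃ q` lies off the dotted circle `K`. [folklore] -/
theorem capMap₃_mem_complement (q : 𝔼 3) : capMap₃ k j q ∈ K.complement := by
  rw [SphereEmbedding.mem_complement_iff, hK]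
  rintro ⟨u, hu⟩
  exact capMap₃_ne_dottedCircle j q u hu.symm

/-- **The cap map** as a continuous map on the (convex) parameter space `ℝ³` with values in the
knot complement. [folklore] -/
def capMapC : C((univ : Set (𝔼 3)), K.complement) where
  toFun q := ⟨capMap₃ k j q, capMap₃_mem_complement j K hK q⟩
  continuous_toFun := ((continuous_capMap₃ j).comp continuous_subtype_val).subtype_mk _

/-- The cap map on points. [folklore] -/
@[simp] theorem coe_capMapC_apply (q : (univ : Set (𝔼 3))) : (capMapC j K hK q : 𝕊 3) = capMap₃ k j q :=
  rfl

/-- The cap map sends the base point to the base point of the thin tube. [folklore] -/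
theorem capMapC_capBase₃ : capMapC j K hK (capBase₃ k j) = (dottedTube j K hK).basePoint := by
  apply Subtype.ext
  rw [coe_capMapC_apply, Knot.TubularNbhd.coe_basePoint, dottedTube_apply_framingBaseVector]
  exact capMap₃_capCircle₃ j 0

/-- **The longitude of the thin tube is the image of the circle under the cap map.** [folklore] -/
theorem longitude_dottedTube : (dottedTube j K hK).longitude =
    (((capLoop₃ k j).map (capMapC j K hK).continuous).cast (capMapC_capBase₃ j K hK).symm
      (capMapC_capBase₃ j K hK).symm) := by
  apply Path.ext
  funext θ
  apply Subtype.ext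
  rw [Knot.TubularNbhd.coe_longitude_apply, dottedTube_apply_framingBaseVector]
  exact (capMap₃_capCircle₃ j _).symm

/-- **The thin tube of a dotted circle has framing `0`**: its longitude is the image of a
null-homotopic loop under a continuous map into the knot complement, so its class in
`π₁(S³ ∖ U_j)ᵃᵇ = H₁(S³ ∖ U_j)` is trivial — the coaxial push-off does not link the round circle
(Rolfsen (1976), §9.G Example 3). [cite: Rolfsen1976, §9.G Example 3] -/
theorem hasFraming_dottedTube : (dottedTube j K hK).HasFraming 0 := by
  unfold Knot.TubularNbhd.HasFraming
  rw [zpow_zero, longitude_dottedTube, Path.Homotopic.Quotient.mk_cast,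
    Path.Homotopic.Quotient.mk_map, Path.Homotopic.Quotient.eq.2 (capLoop₃_homotopic_refl j),
    ← FundamentalGroup.mapOfEq_apply (capMapC j K hK) (capMapC_capBase₃ j K hK),
    Path.Homotopic.Quotient.mk_refl, ← FundamentalGroup.one_def, map_one]
  exact map_one _

end Framing

end MMSW

end Literature.Topology.FourManifolds
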